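import Summits.QuantumAdvantage.QuantumAdvantage.Theses.CubicForrelation

/-!
# Crux `CubicForrelation.NearExactIsExact` (stmt-QuantumAdvantage-14043) — the bent / non-bent decomposition
  (crux-strategist `cstrat-stmt-QuantumAdvantage-14043-s1`, 2026-08-17)

The crux `∃ θ < 1, ∀ even n, ∀ cubic f g, Φ(f,g) > θ ⇒ Φ(f,g) = 1` is the conjunction of two of its CONSEQUENCES,
each a self-contained statement over `forrelation` / `IsDegLeFun` only (bentness of `g` is spelled
`∃ d, Φ(d,g) = 1` — "`g` is bent with dual `d`", cf. the landed `bb_exists_dual` / `two_pow_mul_W_eq`):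

* **NearExactBentIsExact** (the bent side; = the sub-crux that three crux-idea cards isolated independently as
  `DualDistanceGap` / `BentSidedIsolation` / `stub_bentSidedIsolation`): `∃ θ < 1` such that for cubic `f` and cubic BENT `g`,
  `Φ(f,g) > θ ⇒ Φ(f,g) = 1`. Since `Φ(f,g) = 1 − 2·dist(f, g̃)/2ⁿ` for bent `g`, this reads: *the dual of a cubic bent function is
  cubic, or at relative Hamming distance `≥ (1 − θ)/2` from every cubic* — the obstruction "duals of cubic bent functions have
  unbounded degree `(m+3)/2`" (Hou, attained by Gold-type Maiorana–McFarland functions) in isolation.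
* **NearExactIsBent** (the non-bent side): `∃ θ < 1` such that for cubic `f, g`, `Φ(f,g) > θ ⇒ f` or `g` is bent — no pair of two
  NON-bent cubics is `θ`-close to exactness; the obstruction "non-bent cubics are not plateaued: their Walsh capacity
  `E|2^{-n/2} W_g|` accumulates at `1`" (the `𝔽_{2^r}` pencil family of the crux Disproof §4) in isolation.

`NearExactIsExact_of_subs : NearExactBentIsExact → NearExactIsBent → NearExactIsExact` — take `θ = max θ₁ θ₂`; above it one side is
bent (second piece); if it is `g` apply the first piece, if it is `f` apply it to `(g, f)` using the symmetry `Φ(f,g) = Φ(g,f)`.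
Conversely both pieces follow from the crux in one line each (`nearExactBentIsExact_of_crux`, `nearExactIsBent_of_crux`), so a
refutation of either child refutes the parent: the split is SAFE (no child is stronger than the crux).  Both value sets
`{Φ(f,g) : g bent}` and `{Φ(f,g) : f, g non-bent}` are closed under direct sums, so the live line's window amplification
(`Cruxes/NearExactIsExact/Lines/direct_sum_amplification.lean §3`) applies inside each child separately.
-/

set_option linter.dupNamespace false -- D-0017: single-problem summit ⇒ `QuantumAdvantage.QuantumAdvantage` by design

noncomputable section

namespace Summit.QuantumAdvantage.QuantumAdvantage.Theorems.CubicForrelation.NearExactIsExact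

open Finset
open Literature.Computability.QuantumComplexity
open Summit.QuantumAdvantage.QuantumAdvantage.Theses.CubicForrelation (NearExactIsExact)

/-- `Φ(f,g) = Φ(g,f)`: the kernel `(−1)^{x·y}` is symmetric (`twist_comm`) and the double sum may be swapped.
(Restated here so that this file depends on the route file only.) [folklore] -/
theorem split_forrelation_comm {n : ℕ} (f g : (Fin n → Bool) → Bool) : forrelation f g = forrelation g f := by
  unfold forrelation
  congr 1
  rw [Finset.sum_comm]
  refine Finset.sum_congr rfl fun y _ => Finset.sum_congr rfl fun x _ => ?_
  rw [twist_comm]; ring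

/-- **The bent / non-bent decomposition of the crux.** If (i) `∃ θ₁ < 1` isolating exactness among cubic pairs whose
`g` is bent (`∃ d, Φ(d,g) = 1`), and (ii) `∃ θ₂ < 1` above which every cubic pair has a bent side, then
`NearExactIsExact` holds with `θ = max θ₁ θ₂`: above `θ` one side is bent by (ii); if it is `g`, (i) applies; if it is `f`,
(i) applies to the swapped pair, which has the same forrelation. [folklore] -/
theorem NearExactIsExact_of_subs :
    (∃ θ : ℝ, θ < 1 ∧ ∀ n : ℕ, Even n → ∀ f g : (Fin n → Bool) → Bool, IsDegLeFun 3 f → IsDegLeFun 3 g →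
        (∃ d : (Fin n → Bool) → Bool, forrelation d g = 1) → θ < forrelation f g → forrelation f g = 1) →
    (∃ θ : ℝ, θ < 1 ∧ ∀ n : ℕ, Even n → ∀ f g : (Fin n → Bool) → Bool, IsDegLeFun 3 f → IsDegLeFun 3 g →
        θ < forrelation f g →
          (∃ d : (Fin n → Bool) → Bool, forrelation d f = 1) ∨ (∃ d : (Fin n → Bool) → Bool, forrelation d g = 1)) →
    NearExactIsExact := by
  rintro ⟨θ₁, hθ₁, hB⟩ ⟨θ₂, hθ₂, hN⟩
  refine ⟨max θ₁ θ₂, max_lt hθ₁ hθ₂, fun n hn f g hf hg hlt => ?_⟩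
  have h1 : θ₁ < forrelation f g := lt_of_le_of_lt (le_max_left _ _) hlt
  have h2 : θ₂ < forrelation f g := lt_of_le_of_lt (le_max_right _ _) hlt
  rcases hN n hn f g hf hg h2 with hfb | hgb
  · rw [split_forrelation_comm] at h1 ⊢
    exact hB n hn g f hg hf hfb h1
  · exact hB n hn f g hf hg hgb h1

/-- The bent-side child is a CONSEQUENCE of the crux (drop the bentness hypothesis). [folklore] -/
theorem nearExactBentIsExact_of_crux (h : NearExactIsExact) :
    ∃ θ : ℝ, θ < 1 ∧ ∀ n : ℕ, Even n → ∀ f g : (Fin n → Bool) → Bool, IsDegLeFun 3 f → IsDegLeFun 3 g →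
      (∃ d : (Fin n → Bool) → Bool, forrelation d g = 1) → θ < forrelation f g → forrelation f g = 1 := by
  obtain ⟨θ, hθ, h⟩ := h
  exact ⟨θ, hθ, fun n hn f g hf hg _ hlt => h n hn f g hf hg hlt⟩

/-- The non-bent-side child is a CONSEQUENCE of the crux (an exact pair has a bent `g`, with dual `f`). [folklore] -/
theorem nearExactIsBent_of_crux (h : NearExactIsExact) :
    ∃ θ : ℝ, θ < 1 ∧ ∀ n : ℕ, Even n → ∀ f g : (Fin n → Bool) → Bool, IsDegLeFun 3 f → IsDegLeFun 3 g →
      θ < forrelation f g →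
        (∃ d : (Fin n → Bool) → Bool, forrelation d f = 1) ∨ (∃ d : (Fin n → Bool) → Bool, forrelation d g = 1) := by
  obtain ⟨θ, hθ, h⟩ := h
  exact ⟨θ, hθ, fun n hn f g hf hg hlt => Or.inr ⟨f, h n hn f g hf hg hlt⟩⟩

/-- Hence the crux is EQUIVALENT to the conjunction of its two children. [folklore] -/
theorem nearExactIsExact_iff_subs :
    NearExactIsExact ↔
      ((∃ θ : ℝ, θ < 1 ∧ ∀ n : ℕ, Even n → ∀ f g : (Fin n → Bool) → Bool, IsDegLeFun 3 f → IsDegLeFun 3 g →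
          (∃ d : (Fin n → Bool) → Bool, forrelation d g = 1) → θ < forrelation f g → forrelation f g = 1) ∧
       (∃ θ : ℝ, θ < 1 ∧ ∀ n : ℕ, Even n → ∀ f g : (Fin n → Bool) → Bool, IsDegLeFun 3 f → IsDegLeFun 3 g →
          θ < forrelation f g →
            (∃ d : (Fin n → Bool) → Bool, forrelation d f = 1) ∨ (∃ d : (Fin n → Bool) → Bool, forrelation d g = 1))) :=
  ⟨fun h => ⟨nearExactBentIsExact_of_crux h, nearExactIsBent_of_crux h⟩, fun h => NearExactIsExact_of_subs h.1 h.2⟩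

end Summit.QuantumAdvantage.QuantumAdvantage.Theorems.CubicForrelation.NearExactIsExact
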